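import Summits.Ventures.LatticeQCDFlow.Exactness.ReversibleMixture
import Summits.Ventures.LatticeQCDFlow.Exactness.IMHTauIntModelComparison
import Summits.Ventures.LatticeQCDFlow.Exactness.Phi4FlowCrossObservableFloor
import HarnessLib

/-!
# Two flows at one target: POOLING them into one proposal is never worse than ALTERNATING between them, which is never worse than the better flow divided by its weight

HONEST FRAMING: exact (Metropolis-corrected) sampling algorithms for lattice gauge theory;
figures of merit are autocorrelation/cost numbers at stated couplings and volumes; no
continuum-physics claim.  (SCALAR calibration rung S0-A: not a gauge result.)

Venture `LatticeQCDFlow` (cell pub-lqcd), topic `Exactness`; FANOUT row 2 (`s0-phi4`, FLOW arm).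
NEW WORK of the cell: the flow-arm instance of the comparison theorem
(`Exactness/ReversibleComparison.lean`) and of the mixture theorem (`Exactness/ReversibleMixture.lean`),
over the tree's general-measure-space flow-sampler toolbox (`imhOp`, `imhFlow`,
`dirichlet_eq_half_sq`, `integrable_imhFlow_sq_sub`, the `RevOp` instance of
`Phi4FlowCrossObservableFloor`).  Nothing is cited as a fact.  Printed counterparts NAMED ONLY:
Peskun 1973 / Tierney 1998 (off-diagonal order), Tierney 1994 §2.4 (mixtures of kernels).

THE SETTING.  One target weight `w > 0`; two model (flow) densities `q₁, q₂ > 0` (`∫ qᵢ = 1`);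
a weight `0 < a ≤ 1` (`a < 1` for a genuine pair).  Three exact samplers:
* SINGLE: `Kᵢ = imhOp μ w qᵢ` (draw from flow `i`, accept/reject);
* ALTERNATING (kernel mixture): `M = a K₁ + (1 − a) K₂` — toss an `a`-coin, then run `K₁` or `K₂`
  (any operator with `M f x = a K₁ f x + (1 − a) K₂ f x`, hypothesis `hM`);
* POOLED (density mixture): `K̄ = imhOp μ w q̄` with `q̄ = a q₁ + (1 − a) q₂` (any `q̄` with that
  pointwise identity, hypothesis `hq`) — draw from the pooled density and accept/reject against IT.

## What is proved (bounded measurable observables; `C(k) = ∫ g (Kᵏ g) w`, `τ_int` when summable)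

* `imhFlow_mix_le_pooled` — `a s₁ + (1 − a) s₂ ≤ s̄` pointwise for the symmetrised flows
  `sᵢ(t,t') = min(w(t) qᵢ(t'), w(t') qᵢ(t))` (superadditivity of `min`): POOLING DOMINATES
  ALTERNATING OFF THE DIAGONAL (Peskun's order);
* **`dirichlet_mix_le_pooled`** — `a 𝓔₁(v) + (1 − a) 𝓔₂(v) ≤ 𝓔̄(v)`, i.e. `𝓔_M ≤ 𝓔_{K̄}`;
* **`imhPooled_abelSum_le_alternating`** (unconditional) — `Σ_k C̄(k) rᵏ ≤ Σ_k C_M(k) rᵏ` for every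
  bounded measurable `g` and `0 ≤ r < 1`;
* **`imhPooled_tauInt_le_alternating`** — under summability of both series (`P > 0`):
  **`τ̄_int(g) ≤ τ_int,M(g)`**;
* **`imhAlternating_tauInt_add_half_le`** — **`τ_int,M(g) + ½ ≤ (τ_int,1(g) + ½)/a`** (the mixture
  theorem); together with row 4's `imhOp_tauInt_le_of_model_ge` (`q̄ ≥ a q₁ ⇒ τ̄ + ½ ≤ (τ₁ + ½)/a`)
  the chain POOLED ≤ ALTERNATING ≤ (SINGLE + ½)/weight − ½ is complete, observable by observable.

Reading (no numerics implied): for multi-flow samplers (e.g. one flow per topological sector, or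
flows trained at neighbouring couplings) the exact way to combine them is to pool the densities into
one proposal and Metropolis-correct against the pooled density; alternating between the flows is
never better for any observable, and either scheme is never worse than the best single flow for
that observable by more than the inverse of its weight.  NOT CLAIMED: that pooling is cheaper (it
needs every `qᵢ` evaluated at each proposal); strict improvement; any number for any trained flow.
-/

namespace Summit.Ventures.LatticeQCDFlow.Exactness

open Real MeasureTheory Filter Set Topology
open Summit.Ventures.LatticeQCDFlow.Scoring

variable {X : Type*} [MeasurableSpace X] {μ : Measure X} {w q₁ q₂ q : X → ℝ} {a : ℝ}
  {M : (X → ℝ) → (X → ℝ)}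

variable [SFinite μ]

/-! ## §1 Pooling dominates alternating off the diagonal -/

omit [MeasurableSpace X] [SFinite μ] in
/-- **Superadditivity of the symmetrised flow in the model**: with `q̄ = a q₁ + (1 − a) q₂`
(`0 ≤ a ≤ 1`), `a s₁(t,t') + (1 − a) s₂(t,t') ≤ s̄(t,t')`. -/
theorem imhFlow_mix_le_pooled (hq : ∀ s, q s = a * q₁ s + (1 - a) * q₂ s) (ha0 : 0 ≤ a) (ha1 : a ≤ 1)
    (t t' : X) :
    a * imhFlow w q₁ t t' + (1 - a) * imhFlow w q₂ t t' ≤ imhFlow w q t t' := by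
  unfold imhFlow
  rw [hq t', hq t]
  have e1 : w t * (a * q₁ t' + (1 - a) * q₂ t') = a * (w t * q₁ t') + (1 - a) * (w t * q₂ t') := by ring
  have e2 : w t' * (a * q₁ t + (1 - a) * q₂ t) = a * (w t' * q₁ t) + (1 - a) * (w t' * q₂ t) := by ring
  rw [e1, e2]
  have hb : 0 ≤ 1 - a := sub_nonneg.2 ha1
  exact le_min
    (add_le_add (mul_le_mul_of_nonneg_left (min_le_left _ _) ha0)
      (mul_le_mul_of_nonneg_left (min_le_left _ _) hb))
    (add_le_add (mul_le_mul_of_nonneg_left (min_le_right _ _) ha0)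
      (mul_le_mul_of_nonneg_left (min_le_right _ _) hb))

omit [SFinite μ] in
/-- The pooled density is a model density: positive, measurable, integrable, total mass one. -/
theorem pooled_model (hq : ∀ s, q s = a * q₁ s + (1 - a) * q₂ s) (ha0 : 0 < a) (ha1 : a ≤ 1)
    (hq0₁ : ∀ t, 0 < q₁ t) (hqm₁ : Measurable q₁) (hqi₁ : Integrable q₁ μ) (hq1₁ : ∫ t, q₁ t ∂μ = 1)
    (hq0₂ : ∀ t, 0 < q₂ t) (hqm₂ : Measurable q₂) (hqi₂ : Integrable q₂ μ) (hq1₂ : ∫ t, q₂ t ∂μ = 1) :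
    (∀ t, 0 < q t) ∧ Measurable q ∧ Integrable q μ ∧ ∫ t, q t ∂μ = 1 := by
  have e : q = fun s => a * q₁ s + (1 - a) * q₂ s := funext hq
  refine ⟨fun t => ?_, ?_, ?_, ?_⟩
  · rw [hq t]
    exact add_pos_of_pos_of_nonneg (mul_pos ha0 (hq0₁ t))
      (mul_nonneg (sub_nonneg.2 ha1) (hq0₂ t).le)
  · rw [e]; exact (measurable_const.mul hqm₁).add (measurable_const.mul hqm₂)
  · rw [e]; exact (hqi₁.const_mul a).add (hqi₂.const_mul (1 - a))
  · rw [e, integral_add (hqi₁.const_mul a) (hqi₂.const_mul (1 - a)), integral_const_mul,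
      integral_const_mul, hq1₁, hq1₂]
    ring

/-- **THE ALTERNATING KERNEL'S DIRICHLET FORM IS BELOW THE POOLED ONE**: for every bounded measurable
`v`, `a 𝓔₁(v) + (1 − a) 𝓔₂(v) ≤ 𝓔̄(v)` (`𝓔ᵢ = ½ ∫∫ sᵢ (v − v')²`, `dirichlet_eq_half_sq`). -/
theorem dirichlet_mix_le_pooled (hw0 : ∀ t, 0 < w t) (hwm : Measurable w) (hwi : Integrable w μ)
    (hq0₁ : ∀ t, 0 < q₁ t) (hqm₁ : Measurable q₁) (hqi₁ : Integrable q₁ μ) (hq1₁ : ∫ t, q₁ t ∂μ = 1)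
    (hq0₂ : ∀ t, 0 < q₂ t) (hqm₂ : Measurable q₂) (hqi₂ : Integrable q₂ μ) (hq1₂ : ∫ t, q₂ t ∂μ = 1)
    (hq : ∀ s, q s = a * q₁ s + (1 - a) * q₂ s) (ha0 : 0 < a) (ha1 : a ≤ 1)
    {v : X → ℝ} (hvm : Measurable v) {B : ℝ} (hvb : ∀ t, |v t| ≤ B) :
    a * ((∫ t, v t ^ 2 * w t ∂μ) - ∫ t, v t * imhOp μ w q₁ v t * w t ∂μ)
        + (1 - a) * ((∫ t, v t ^ 2 * w t ∂μ) - ∫ t, v t * imhOp μ w q₂ v t * w t ∂μ)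
      ≤ (∫ t, v t ^ 2 * w t ∂μ) - ∫ t, v t * imhOp μ w q v t * w t ∂μ := by
  obtain ⟨hq0, hqm, hqi, hq1⟩ := pooled_model hq ha0 ha1 hq0₁ hqm₁ hqi₁ hq1₁ hq0₂ hqm₂ hqi₂ hq1₂
  rw [dirichlet_eq_half_sq hw0 hwm hwi hq0₁ hqm₁ hqi₁ hq1₁ hvm hvb,
    dirichlet_eq_half_sq hw0 hwm hwi hq0₂ hqm₂ hqi₂ hq1₂ hvm hvb,
    dirichlet_eq_half_sq hw0 hwm hwi hq0 hqm hqi hq1 hvm hvb]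
  have i1 := integrable_imhFlow_sq_sub hw0 hwm hwi hq0₁ hqm₁ hqi₁ hvm hvb
  have i2 := integrable_imhFlow_sq_sub hw0 hwm hwi hq0₂ hqm₂ hqi₂ hvm hvb
  have i3 := integrable_imhFlow_sq_sub hw0 hwm hwi hq0 hqm hqi hvm hvb
  have hsum : a * ∫ p, imhFlow w q₁ p.1 p.2 * (v p.1 - v p.2) ^ 2 ∂(μ.prod μ)
        + (1 - a) * ∫ p, imhFlow w q₂ p.1 p.2 * (v p.1 - v p.2) ^ 2 ∂(μ.prod μ)
      = ∫ p, (a * (imhFlow w q₁ p.1 p.2 * (v p.1 - v p.2) ^ 2)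
          + (1 - a) * (imhFlow w q₂ p.1 p.2 * (v p.1 - v p.2) ^ 2)) ∂(μ.prod μ) := by
    rw [integral_add (i1.const_mul a) (i2.const_mul (1 - a)), integral_const_mul, integral_const_mul]
  have hmono : ∫ p, (a * (imhFlow w q₁ p.1 p.2 * (v p.1 - v p.2) ^ 2)
          + (1 - a) * (imhFlow w q₂ p.1 p.2 * (v p.1 - v p.2) ^ 2)) ∂(μ.prod μ)
      ≤ ∫ p, imhFlow w q p.1 p.2 * (v p.1 - v p.2) ^ 2 ∂(μ.prod μ) := by
    refine integral_mono ((i1.const_mul a).add (i2.const_mul (1 - a))) i3 fun p => ?_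
    show a * (imhFlow w q₁ p.1 p.2 * (v p.1 - v p.2) ^ 2)
        + (1 - a) * (imhFlow w q₂ p.1 p.2 * (v p.1 - v p.2) ^ 2)
      ≤ imhFlow w q p.1 p.2 * (v p.1 - v p.2) ^ 2
    have h := imhFlow_mix_le_pooled (w := w) hq ha0.le ha1 p.1 p.2
    nlinarith [mul_le_mul_of_nonneg_right h (sq_nonneg (v p.1 - v p.2))]
  nlinarith [hsum, hmono]

/-! ## §2 The comparisons -/

section RevOpInstance

/-- The `RevOp` hypotheses of the flow sampler with model `q` on bounded measurable observables,
packaged (all from the tree's flow toolbox). -/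
theorem imhOp_revOp (hw0 : ∀ t, 0 < w t) (hwm : Measurable w) (hwi : Integrable w μ)
    (hq0 : ∀ t, 0 < q t) (hqm : Measurable q) (hqi : Integrable q μ) (hq1 : ∫ t, q t ∂μ = 1) :
    (∀ ⦃f : X → ℝ⦄, (Measurable f ∧ ∃ B : ℝ, ∀ t, |f t| ≤ B) →
        (Measurable (imhOp μ w q f) ∧ ∃ B : ℝ, ∀ t, |imhOp μ w q f t| ≤ B)) ∧
    (∀ ⦃f h : X → ℝ⦄ (c : ℝ), (Measurable f ∧ ∃ B : ℝ, ∀ t, |f t| ≤ B) →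
        (Measurable h ∧ ∃ B : ℝ, ∀ t, |h t| ≤ B) →
        ∀ x, imhOp μ w q (fun s => f s + c * h s) x = imhOp μ w q f x + c * imhOp μ w q h x) ∧
    (∀ ⦃f h : X → ℝ⦄, (Measurable f ∧ ∃ B : ℝ, ∀ t, |f t| ≤ B) →
        (Measurable h ∧ ∃ B : ℝ, ∀ t, |h t| ≤ B) →
        ∫ x, imhOp μ w q f x * h x * w x ∂μ = ∫ x, f x * imhOp μ w q h x * w x ∂μ) ∧
    (∀ ⦃f : X → ℝ⦄, (Measurable f ∧ ∃ B : ℝ, ∀ t, |f t| ≤ B) →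
        ∫ x, imhOp μ w q f x ^ 2 * w x ∂μ ≤ ∫ x, f x ^ 2 * w x ∂μ) := by
  refine ⟨fun f hf => ?_, fun f h l hf hh t => ?_, fun f h hf hh => ?_, fun f hf => ?_⟩
  · obtain ⟨hfm', Bf, hfb'⟩ := hf
    exact ⟨measurable_imhOp hwm hqm hfm', Bf, imhOp_abs_le hw0 hq0 hqi hq1 hfb'⟩
  · obtain ⟨hfm', Bf, hfb'⟩ := hf
    obtain ⟨hhm', Bh, hhb'⟩ := hh
    exact imhOp_add_mul hw0 hwm hq0 hqm hqi hfm' hhm' hfb' hhb' l t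
  · obtain ⟨hfm', Bf, hfb'⟩ := hf
    obtain ⟨hhm', Bh, hhb'⟩ := hh
    exact integral_imhOp_mul_mul_comm hw0 hwm hwi hq0 hqm hqi hfm' hhm' hfb' hhb'
  · obtain ⟨hfm', Bf, hfb'⟩ := hf
    exact integral_imhOp_sq_le_integral_sq hw0 hwm hwi hq0 hqm hqi hq1 hfm' hfb'

omit [SFinite μ] in
/-- (int) and (comb) for the bounded measurable class. -/
theorem bddMeas_class (hw0 : ∀ t, 0 < w t) (hwm : Measurable w) (hwi : Integrable w μ) :
    (∀ ⦃f h : X → ℝ⦄, (Measurable f ∧ ∃ B : ℝ, ∀ t, |f t| ≤ B) →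
        (Measurable h ∧ ∃ B : ℝ, ∀ t, |h t| ≤ B) → Integrable (fun x => f x * h x * w x) μ) ∧
    (∀ ⦃f h : X → ℝ⦄ (c : ℝ), (Measurable f ∧ ∃ B : ℝ, ∀ t, |f t| ≤ B) →
        (Measurable h ∧ ∃ B : ℝ, ∀ t, |h t| ≤ B) →
        (Measurable (fun x => f x + c * h x) ∧ ∃ B : ℝ, ∀ t, |f t + c * h t| ≤ B)) := by
  refine ⟨fun f h hf hh => ?_, fun f h l hf hh => ?_⟩
  · obtain ⟨hfm', Bf, hfb'⟩ := hf
    obtain ⟨hhm', Bh, hhb'⟩ := hh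
    exact integrable_mul_mul_weight hw0 hwm hwi hfm' hhm' hfb' hhb'
  · obtain ⟨hfm', Bf, hfb'⟩ := hf
    obtain ⟨hhm', Bh, hhb'⟩ := hh
    refine ⟨hfm'.add (measurable_const.mul hhm'), Bf + |l| * Bh, fun t => ?_⟩
    calc |f t + l * h t| ≤ |f t| + |l * h t| := abs_add_le _ _
      _ ≤ Bf + |l| * Bh := by
          rw [abs_mul]; exact add_le_add (hfb' t) (mul_le_mul_of_nonneg_left (hhb' t) (abs_nonneg _))

end RevOpInstance

/-- **POOLED ≤ ALTERNATING, ABEL FORM (unconditional).**  For every bounded measurable `g` and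
`0 ≤ r < 1`:  `Σ_k C̄(k) rᵏ ≤ Σ_k C_M(k) rᵏ`, where `C̄` are the autocovariances under the pooled
sampler `imhOp μ w q̄` and `C_M` under the alternating sampler `M = a K₁ + (1 − a) K₂`. -/
theorem imhPooled_abelSum_le_alternating (hw0 : ∀ t, 0 < w t) (hwm : Measurable w)
    (hwi : Integrable w μ)
    (hq0₁ : ∀ t, 0 < q₁ t) (hqm₁ : Measurable q₁) (hqi₁ : Integrable q₁ μ) (hq1₁ : ∫ t, q₁ t ∂μ = 1)
    (hq0₂ : ∀ t, 0 < q₂ t) (hqm₂ : Measurable q₂) (hqi₂ : Integrable q₂ μ) (hq1₂ : ∫ t, q₂ t ∂μ = 1)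
    (hq : ∀ s, q s = a * q₁ s + (1 - a) * q₂ s) (ha0 : 0 < a) (ha1 : a ≤ 1)
    (hM : ∀ f x, M f x = a * imhOp μ w q₁ f x + (1 - a) * imhOp μ w q₂ f x)
    {g : X → ℝ} (hgm : Measurable g) {Bg : ℝ} (hgb : ∀ t, |g t| ≤ Bg)
    {r : ℝ} (hr0 : 0 ≤ r) (hr1 : r < 1) :
    ∑' k, (∫ t, g t * ((imhOp μ w q)^[k] g) t * w t ∂μ) * r ^ k
      ≤ ∑' k, (∫ t, g t * (M^[k] g) t * w t ∂μ) * r ^ k := by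
  obtain ⟨hq0, hqm, hqi, hq1⟩ := pooled_model hq ha0 ha1 hq0₁ hqm₁ hqi₁ hq1₁ hq0₂ hqm₂ hqi₂ hq1₂
  obtain ⟨hAi, hAc⟩ := bddMeas_class (μ := μ) hw0 hwm hwi
  obtain ⟨hS₁, hL₁, hY₁, hC₁⟩ := imhOp_revOp (μ := μ) hw0 hwm hwi hq0₁ hqm₁ hqi₁ hq1₁
  obtain ⟨hS₂, hL₂, hY₂, hC₂⟩ := imhOp_revOp (μ := μ) hw0 hwm hwi hq0₂ hqm₂ hqi₂ hq1₂
  obtain ⟨hS, hL, hY, hC⟩ := imhOp_revOp (μ := μ) hw0 hwm hwi hq0 hqm hqi hq1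
  exact RevOp.abelSum_le_of_dirichlet_le (μ := μ)
    (A := fun f : X → ℝ => Measurable f ∧ ∃ B : ℝ, ∀ t, |f t| ≤ B)
    (K := M) (K' := imhOp μ w q) (w := w) (fun t => (hw0 t).le) hAi hAc
    (fun _ hf => RevOp.mix_mem hAc hS₁ hS₂ hM hf)
    (fun _ _ c hf hh x => RevOp.mix_add_mul hL₁ hL₂ hM c hf hh x)
    (fun _ _ hf hh => RevOp.mix_symm hAi hS₁ hS₂ hY₁ hY₂ hM hf hh)
    (fun _ hf => RevOp.mix_contr (fun t => (hw0 t).le) hAi hAc hS₁ hS₂ hC₁ hC₂ hM ha0.le ha1 hf)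
    hS hL hY hC
    (fun v hv => by
      obtain ⟨hvm, B, hvb⟩ := hv
      rw [RevOp.dirichlet_mix_eq hAi hS₁ hS₂ hM ⟨hvm, B, hvb⟩]
      exact dirichlet_mix_le_pooled hw0 hwm hwi hq0₁ hqm₁ hqi₁ hq1₁ hq0₂ hqm₂ hqi₂ hq1₂ hq ha0 ha1
        hvm hvb)
    ⟨hgm, Bg, hgb⟩ hr0 hr1

/-- **POOLED ≤ ALTERNATING FOR `τ_int`.**  If the normalised autocorrelation series of the bounded
measurable `g` (`∫ g² w > 0`) are summable under both samplers, then `τ̄_int(g) ≤ τ_int,M(g)`: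
one accept/reject against the pooled density is never slower than alternating between the flows. -/
theorem imhPooled_tauInt_le_alternating (hw0 : ∀ t, 0 < w t) (hwm : Measurable w)
    (hwi : Integrable w μ)
    (hq0₁ : ∀ t, 0 < q₁ t) (hqm₁ : Measurable q₁) (hqi₁ : Integrable q₁ μ) (hq1₁ : ∫ t, q₁ t ∂μ = 1)
    (hq0₂ : ∀ t, 0 < q₂ t) (hqm₂ : Measurable q₂) (hqi₂ : Integrable q₂ μ) (hq1₂ : ∫ t, q₂ t ∂μ = 1)
    (hq : ∀ s, q s = a * q₁ s + (1 - a) * q₂ s) (ha0 : 0 < a) (ha1 : a ≤ 1)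
    (hM : ∀ f x, M f x = a * imhOp μ w q₁ f x + (1 - a) * imhOp μ w q₂ f x)
    {g : X → ℝ} (hgm : Measurable g) {Bg : ℝ} (hgb : ∀ t, |g t| ≤ Bg)
    (hP : 0 < ∫ t, g t ^ 2 * w t ∂μ)
    (hsM : Summable fun k => (∫ t, g t * (M^[k + 1] g) t * w t ∂μ) / ∫ t, g t ^ 2 * w t ∂μ)
    (hsP : Summable fun k => (∫ t, g t * ((imhOp μ w q)^[k + 1] g) t * w t ∂μ)
      / ∫ t, g t ^ 2 * w t ∂μ) :
    tauInt (fun k => (∫ t, g t * ((imhOp μ w q)^[k] g) t * w t ∂μ) / ∫ t, g t ^ 2 * w t ∂μ)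
      ≤ tauInt (fun k => (∫ t, g t * (M^[k] g) t * w t ∂μ) / ∫ t, g t ^ 2 * w t ∂μ) := by
  obtain ⟨hq0, hqm, hqi, hq1⟩ := pooled_model hq ha0 ha1 hq0₁ hqm₁ hqi₁ hq1₁ hq0₂ hqm₂ hqi₂ hq1₂
  obtain ⟨hAi, hAc⟩ := bddMeas_class (μ := μ) hw0 hwm hwi
  obtain ⟨hS₁, hL₁, hY₁, hC₁⟩ := imhOp_revOp (μ := μ) hw0 hwm hwi hq0₁ hqm₁ hqi₁ hq1₁
  obtain ⟨hS₂, hL₂, hY₂, hC₂⟩ := imhOp_revOp (μ := μ) hw0 hwm hwi hq0₂ hqm₂ hqi₂ hq1₂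
  obtain ⟨hS, hL, hY, -⟩ := imhOp_revOp (μ := μ) hw0 hwm hwi hq0 hqm hqi hq1
  exact RevOp.tauInt_le_of_dirichlet_le (μ := μ)
    (A := fun f : X → ℝ => Measurable f ∧ ∃ B : ℝ, ∀ t, |f t| ≤ B)
    (K := M) (K' := imhOp μ w q) (w := w) (fun t => (hw0 t).le) hAi hAc
    (fun _ hf => RevOp.mix_mem hAc hS₁ hS₂ hM hf)
    (fun _ _ c hf hh x => RevOp.mix_add_mul hL₁ hL₂ hM c hf hh x)
    (fun _ _ hf hh => RevOp.mix_symm hAi hS₁ hS₂ hY₁ hY₂ hM hf hh)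
    (fun _ hf => RevOp.mix_contr (fun t => (hw0 t).le) hAi hAc hS₁ hS₂ hC₁ hC₂ hM ha0.le ha1 hf)
    hS hL hY
    (fun v hv => by
      obtain ⟨hvm, B, hvb⟩ := hv
      rw [RevOp.dirichlet_mix_eq hAi hS₁ hS₂ hM ⟨hvm, B, hvb⟩]
      exact dirichlet_mix_le_pooled hw0 hwm hwi hq0₁ hqm₁ hqi₁ hq1₁ hq0₂ hqm₂ hqi₂ hq1₂ hq ha0 ha1
        hvm hvb)
    ⟨hgm, Bg, hgb⟩ hP hsM hsP

/-- **ALTERNATING ≤ (SINGLE + ½)/WEIGHT − ½.**  For the alternating sampler `M = a K₁ + (1 − a) K₂`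
and every bounded measurable `g` (`∫ g² w > 0`) with summable normalised series under `K₁` and `M`:
`τ_int,M(g) + ½ ≤ (τ_int,1(g) + ½) / a`. -/
theorem imhAlternating_tauInt_add_half_le (hw0 : ∀ t, 0 < w t) (hwm : Measurable w)
    (hwi : Integrable w μ)
    (hq0₁ : ∀ t, 0 < q₁ t) (hqm₁ : Measurable q₁) (hqi₁ : Integrable q₁ μ) (hq1₁ : ∫ t, q₁ t ∂μ = 1)
    (hq0₂ : ∀ t, 0 < q₂ t) (hqm₂ : Measurable q₂) (hqi₂ : Integrable q₂ μ) (hq1₂ : ∫ t, q₂ t ∂μ = 1)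
    (ha0 : 0 < a) (ha1 : a ≤ 1)
    (hM : ∀ f x, M f x = a * imhOp μ w q₁ f x + (1 - a) * imhOp μ w q₂ f x)
    {g : X → ℝ} (hgm : Measurable g) {Bg : ℝ} (hgb : ∀ t, |g t| ≤ Bg)
    (hP : 0 < ∫ t, g t ^ 2 * w t ∂μ)
    (hs₁ : Summable fun k => (∫ t, g t * ((imhOp μ w q₁)^[k + 1] g) t * w t ∂μ)
      / ∫ t, g t ^ 2 * w t ∂μ)
    (hsM : Summable fun k => (∫ t, g t * (M^[k + 1] g) t * w t ∂μ) / ∫ t, g t ^ 2 * w t ∂μ) :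
    tauInt (fun k => (∫ t, g t * (M^[k] g) t * w t ∂μ) / ∫ t, g t ^ 2 * w t ∂μ) + 1 / 2
      ≤ (tauInt (fun k => (∫ t, g t * ((imhOp μ w q₁)^[k] g) t * w t ∂μ) / ∫ t, g t ^ 2 * w t ∂μ)
          + 1 / 2) / a := by
  obtain ⟨hAi, hAc⟩ := bddMeas_class (μ := μ) hw0 hwm hwi
  obtain ⟨hS₁, hL₁, hY₁, hC₁⟩ := imhOp_revOp (μ := μ) hw0 hwm hwi hq0₁ hqm₁ hqi₁ hq1₁
  obtain ⟨hS₂, hL₂, hY₂, hC₂⟩ := imhOp_revOp (μ := μ) hw0 hwm hwi hq0₂ hqm₂ hqi₂ hq1₂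
  exact RevOp.tauInt_mix_add_half_le (μ := μ)
    (A := fun f : X → ℝ => Measurable f ∧ ∃ B : ℝ, ∀ t, |f t| ≤ B)
    (K₁ := imhOp μ w q₁) (K₂ := imhOp μ w q₂) (M := M) (w := w) (fun t => (hw0 t).le) hAi hAc
    hS₁ hS₂ hL₁ hL₂ hY₁ hY₂ hC₁ hC₂ hM ha0 ha1 ⟨hgm, Bg, hgb⟩ hP hs₁ hsM

end Summit.Ventures.LatticeQCDFlow.Exactness
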